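import Summits.ResolutionOfSingularities.ResolutionOfSingularities.Theorems.CompanionHasse
import HarnessLib

/-!
# CompanionPresentation — decomp-res node «CompanionCut» (lens-4 g26, critic row 154), tree file 3/7 of the node

Content VERBATIM from the decomp-res lens-4 g26 node `HOME/decomp-res-lens-4/g26/CompanionCut.lean` (pin 12d9bf52, 1
262 l, 56 declarations;
HOME = run/shared/lean/pub/decomp-res) = ONE NEW PART §66–§70, NO CARRY, on top of the landed
`Theorems/HeightCutCells` (g25) +
`Theorems/MaxContactCutKangarooCut` (h71 wiring) + `Theorems/ContactFreeIsPPower` (lens-6).  Critic: CRITIC-LEDGER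
row 154 (CLEARED
2026-08-30T23:45:15Z, DECIDED +1 (ii*): THE COMPANION LAW at every weight — Hasse descent of a `p^e`-power form to
a weight-`p^e`
companion with LINEAR weak contact, Giraud transport with a typed jump dichotomy in every weight, the deciding implication
«eventually companion-jump-free ⇒ 31571's class» and the EXACT re-location of the g25 residual
`NoWildKangarooOffDoublePointTowers`
to the companion-recurrent towers `NoWildCompanionKangarooTowers`; inhabitants both sides).  Landing orders INBOX
:519 (lens-4 g26
landing note, split per NEXT-g27 §4) and :528 (critic): `--kind proof --supports
stmt-ResolutionOfSingularities-28338`, namespace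
`…Theorems.HugValuationCut`.  Landed by decomp-res writer g8 CONE-AWARE in seven files: `CompanionAlgebra` ·
`CompanionHasse` ·
`CompanionPresentation` (§66–§67) · `CompanionTransport` (§68) · `CompanionTowers` (§69) ·
`CompanionCutCells` (§70 cone-free cells and
hypothesis-free re-locations) are OUTSIDE the Theses cone (importable by the route file); the five §70 corollaries GIVEN 31571
`MaxContactCut.NoContactHuggingTowers` BY NAME are the in-cone wiring file `MaxContactCutCompanionCut`.  Aside
bookkeeping (row 154):
ONE successor aside on the lens-4 column, `NoWildCompanionKangarooTowers` (home `CompanionCutCells`) SUPERSEDING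
`HCNoWildKangarooOffDoublePointTowers` (g25, route rev 43); exactness `noWildKangarooOffDoublePointTowers_iff_companion (h71)`;
the decided cell `NoWildCompanionJumpFreeTowers` (⟸ 31571, `noWildCompanionJumpFreeTowers_of_item`) is not filed.

§66, last third (L1 at ring level): `eval_pow_mem_powSpan_of_coeff`, the Frobenius-maximal presentation
`exists_companion_presentation`,
the companion element with linear weak contact `exists_companion_of_presentation`; and §67 (l. 626–713) THE
SCHEME-LEVEL COMPANION over a
perfect field: `CompanionContactAt` (NEW OBJECT, support definition), `exists_frobExp`, `companionContactAt_of_pPowerFormAt`,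
`exists_companionContactAt`.  PROVED, 0 sorry.  Imports `CompanionHasse`.  Cone-free.

[WRITER NOTE (decomp-res writer g8): section split only (400-line cap; §66 `section CompanionAlgebra` is re-opened
with the same
`variable` lines in `CompanionHasse` / `CompanionPresentation`); namespace, universes, section variables and every
declaration exactly
as in the lens (global `set_option` dropped; the lens's in-cone import `MaxContactCutKangarooCut` and the `open
…Theses` line live only
in the wiring file `MaxContactCutCompanionCut`).]

(Sources: Giraud1975 Thm 5.2; EncinasVillamayor2000 Thm 4.9; BravoGarciaEscamillaEncinasVillamayor2012 Lemma 4.6;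
KawanoueMatsuki2010; Kawanoue arXiv:math/0607009; CossartPiltant2008 §2; Cossart2011 ex. III.2; Hauser
arXiv:0811.4151; FruehbisKrueger arXiv:1007.2203 §3; BenitoVillamayor arXiv:1004.1803; Lucas 1878.)
-/

noncomputable section

open CategoryTheory AlgebraicGeometry IsLocalRing
open Literature.AlgebraicGeometry.Resolution
open Summit.ResolutionOfSingularities.ResolutionOfSingularities.Theorems
open WeakOrderReduction ForcedTowerClasses DivergentTowerClasses MonomialTowerClasses
open HugDimensionClasses HugDimensionKernels SurfaceShadowClasses SurfaceShadowKernels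
open NearPointCut (SingularClass)
open AbsoluteContactClasses (IsAbsContactAt SepResidueAt diffIdeal_restrict_le stalkMap_comp_toStalk_eq_stalkHom)
open scoped BigOperators

namespace Summit.ResolutionOfSingularities.ResolutionOfSingularities.Theorems.HugValuationCut

section CompanionAlgebra

variable {k R : Type*} [CommRing k] [CommRing R] [Algebra k R]

variable {ι : Type*} [Fintype ι]

omit [Algebra k R] in
/-- Frobenius bookkeeping: if every unit-coefficient monomial of the form `Q` (degree `m`) has all exponents `≡ 0
(mod p)`, then
`Q(u^w) ∈ ⟨h^{p w} : h ∈ M^{m/p}⟩ + M^{w m + 1}` (g24 `mem_pPowerSpan_of_coeff` one Frobenius level up). [folklore] -/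
theorem eval_pow_mem_powSpan_of_coeff {u : ι → R} {M : Ideal R} (hum : ∀ i, u i ∈ M) {m p : ℕ} (hp : p.Prime) (w : ℕ)
    (Q : MvPolynomial ι R) (hQ : Q.IsHomogeneous m) (hcoeff : ∀ d ∈ Q.support, Q.coeff d ∈ M ∨ ∀ i, p ∣ d i) :
    MvPolynomial.eval (fun i => u i ^ w) Q ∈
      Ideal.span ((fun h : R => h ^ (p * w)) '' ↑(M ^ (m / p))) ⊔ M ^ (w * m + 1) := by
  classical
  have hmon : ∀ β : ι →₀ ℕ, (∏ i, u i ^ β i) ∈ M ^ β.degree := fun β => prod_pow_mem_pow_degree hum β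
  have hdeg : ∀ d ∈ Q.support, Finsupp.degree d = m := fun d hd => by
    rw [Finsupp.degree_eq_weight_one]; exact hQ (MvPolynomial.mem_support_iff.mp hd)
  have hvpow : ∀ β : ι →₀ ℕ, (∏ l, (u l ^ w) ^ β l) = (∏ l, u l ^ β l) ^ w := fun β => by
    rw [← Finset.prod_pow]
    exact Finset.prod_congr rfl fun l _ => by rw [← pow_mul, ← pow_mul, mul_comm]
  rw [MvPolynomial.eval_eq']
  refine Ideal.sum_mem _ fun d hd => ?_
  rw [hvpow]
  rcases hcoeff d hd with hc | hdiv
  · refine Ideal.mem_sup_right ?_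
    have : Q.coeff d * (∏ i, u i ^ d i) ^ w ∈ M * M ^ (w * m) := by
      refine Ideal.mul_mem_mul hc ?_
      rw [mul_comm, pow_mul]
      exact Ideal.pow_mem_pow (hdeg d hd ▸ hmon d) w
    rwa [← pow_succ'] at this
  · refine Ideal.mem_sup_left (Ideal.mul_mem_left _ _ ?_)
    let d' : ι →₀ ℕ := Finsupp.mapRange (fun n => n / p) (Nat.zero_div p) d
    have hd' : ∀ i, d i = p * d' i := fun i => by
      rw [Finsupp.mapRange_apply]; exact (Nat.mul_div_cancel' (hdiv i)).symm
    have hprod : (∏ i, u i ^ d i) = (∏ i, u i ^ d' i) ^ p := by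
      rw [← Finset.prod_pow]
      exact Finset.prod_congr rfl fun i _ => by rw [hd' i, pow_mul, ← pow_mul, ← pow_mul, mul_comm]
    have hsum : p * d'.degree = m := by
      rw [← hdeg d hd, Finsupp.degree_eq_sum, Finsupp.degree_eq_sum, Finset.mul_sum]
      exact Finset.sum_congr rfl fun i _ => (hd' i).symm
    have hd'deg : d'.degree = m / p := by
      rw [← hsum, Nat.mul_div_cancel_left _ hp.pos]
    rw [hprod, ← pow_mul]
    exact Ideal.subset_span ⟨_, by simpa [hd'deg] using hmon d', rfl⟩

omit [Algebra k R] in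
/-- **THE FROBENIUS EXPONENT SELECTS A LUCAS MONOMIAL (KERNEL, PROVED)**: if `J` is a `p^e`-power form of order `n` at `𝔪`
but NOT a `p^{e+1}`-power form, some `f ∈ J` has initial form `Q(u^{p^e})` (`Q` of degree `n/p^e`) with a unit coefficient at
a multi-index having an exponent `≢ 0 (mod p)`. [folklore; Hironaka1970Additive; CossartPiltant2008 §2] [folklore] -/
theorem exists_companion_presentation [IsLocalRing R] (p : ℕ) [Fact p.Prime] [CharP R p] {u : ι → R}
    (hu : Ideal.span (Set.range u) = maximalIdeal R) {n : ℕ} (e : ℕ) (hen : p ^ e ∣ n) {J : Ideal R}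
    (hJ : J ≤ Ideal.span ((fun h : R => h ^ (p ^ e)) '' ↑(maximalIdeal R ^ (n / p ^ e))) ⊔ maximalIdeal R ^ (n + 1))
    (hJ1 : ¬ J ≤ maximalIdeal R ^ (n + 1))
    (hJ2 : ¬ (p ^ (e + 1) ∣ n ∧
      J ≤ Ideal.span ((fun h : R => h ^ (p ^ (e + 1))) '' ↑(maximalIdeal R ^ (n / p ^ (e + 1)))) ⊔
        maximalIdeal R ^ (n + 1))) :
    ∃ f ∈ J, ∃ Q : MvPolynomial ι R, Q.IsHomogeneous (n / p ^ e) ∧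
      f - MvPolynomial.eval (fun i => u i ^ (p ^ e)) Q ∈ maximalIdeal R ^ (n + 1) ∧
      ∃ α₀ ∈ Q.support, Q.coeff α₀ ∉ maximalIdeal R ∧ ∃ i, ¬ p ∣ α₀ i := by
  classical
  have hp : p.Prime := Fact.out
  set w : ℕ := p ^ e with hw
  set m : ℕ := n / w with hm
  have hnm : n = w * m := (Nat.mul_div_cancel' hen).symm
  have hum : ∀ i, u i ∈ maximalIdeal R := fun i => hu ▸ Ideal.subset_span ⟨i, rfl⟩
  have hmon : ∀ β : ι →₀ ℕ, (∏ i, u i ^ β i) ∈ maximalIdeal R ^ β.degree := fun β => prod_pow_mem_pow_degree hum β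
  -- every `f ∈ J` has a Frobenius-twisted presentation
  have pres : ∀ f ∈ J, ∃ Q : MvPolynomial ι R, Q.IsHomogeneous m ∧
      f - MvPolynomial.eval (fun i => u i ^ w) Q ∈ maximalIdeal R ^ (n + 1) := fun f hf => by
    obtain ⟨g, hg, r, hr, hgr⟩ := Submodule.mem_sup.mp (hJ hf)
    rw [← hu] at hg
    obtain ⟨Q, hQ, hQg⟩ := exists_isHomogeneous_eval_pow_of_mem_span p e m u hg
    exact ⟨Q, hQ, by rw [hQg, ← hgr, add_sub_cancel_left]; exact hr⟩
  have hpw : p * w = p ^ (e + 1) := by rw [hw, pow_succ']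
  have hmp : m / p = n / p ^ (e + 1) := by rw [hm, Nat.div_div_eq_div_mul, hw, ← pow_succ]
  by_cases hpe : p ^ (e + 1) ∣ n
  · obtain ⟨f, hfJ, hf2⟩ : ∃ f ∈ J, f ∉ Ideal.span ((fun h : R => h ^ (p ^ (e + 1))) ''
        ↑(maximalIdeal R ^ (n / p ^ (e + 1)))) ⊔ maximalIdeal R ^ (n + 1) := by
      by_contra hcon
      push Not at hcon
      exact hJ2 ⟨hpe, hcon⟩
    obtain ⟨Q, hQ, hfQ⟩ := pres f hfJ
    refine ⟨f, hfJ, Q, hQ, hfQ, ?_⟩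
    by_contra hcon
    push Not at hcon
    apply hf2
    have hcoeff : ∀ d ∈ Q.support, Q.coeff d ∈ maximalIdeal R ∨ ∀ i, p ∣ d i := fun d hd => by
      by_cases h : Q.coeff d ∈ maximalIdeal R
      · exact Or.inl h
      · exact Or.inr (hcon d hd h)
    have h1 := eval_pow_mem_powSpan_of_coeff hum hp w Q hQ hcoeff
    rw [hpw, hmp, ← hnm] at h1
    have : f = MvPolynomial.eval (fun i => u i ^ w) Q + (f - MvPolynomial.eval (fun i => u i ^ w) Q) := by ring
    rw [this]
    exact add_mem h1 (Ideal.mem_sup_right hfQ)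
  · obtain ⟨f, hfJ, hf2⟩ : ∃ f ∈ J, f ∉ maximalIdeal R ^ (n + 1) := by
      by_contra hcon
      push Not at hcon
      exact hJ1 hcon
    obtain ⟨Q, hQ, hfQ⟩ := pres f hfJ
    refine ⟨f, hfJ, Q, hQ, hfQ, ?_⟩
    by_contra hcon
    push Not at hcon
    by_cases hex : ∃ d ∈ Q.support, Q.coeff d ∉ maximalIdeal R
    · obtain ⟨d, hd, hdc⟩ := hex
      have hdiv : ∀ i, p ∣ d i := hcon d hd hdc
      apply hpe
      have hdeg : d.degree = m := by
        rw [Finsupp.degree_eq_weight_one]; exact hQ (MvPolynomial.mem_support_iff.mp hd)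
      have hpm : p ∣ m := by
        rw [← hdeg, Finsupp.degree_eq_sum]
        exact Finset.dvd_sum fun i _ => hdiv i
      rw [hnm, hw, pow_succ]
      exact Nat.mul_dvd_mul_left _ hpm
    · push Not at hex
      apply hf2
      have h1 : MvPolynomial.eval (fun i => u i ^ w) Q ∈ maximalIdeal R ^ (n + 1) := by
        rw [MvPolynomial.eval_eq']
        refine Ideal.sum_mem _ fun d hd => ?_
        have hdeg : d.degree = m := by
          rw [Finsupp.degree_eq_weight_one]; exact hQ (MvPolynomial.mem_support_iff.mp hd)
        have hvpow : (∏ l, (u l ^ w) ^ d l) = (∏ l, u l ^ d l) ^ w := by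
          rw [← Finset.prod_pow]
          exact Finset.prod_congr rfl fun l _ => by rw [← pow_mul, ← pow_mul, mul_comm]
        have : Q.coeff d * (∏ l, (u l ^ w) ^ d l) ∈ maximalIdeal R * maximalIdeal R ^ (w * m) := by
          refine Ideal.mul_mem_mul (hex d hd) ?_
          rw [hvpow, mul_comm, pow_mul]
          exact Ideal.pow_mem_pow (hdeg ▸ hmon d) w
        rwa [← pow_succ', ← hnm] at this
      have : f = MvPolynomial.eval (fun i => u i ^ w) Q + (f - MvPolynomial.eval (fun i => u i ^ w) Q) := by ring
      rw [this]
      exact add_mem h1 hfQ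

/-- **RING-LEVEL COMPANION CONTACT (KERNEL, PROVED)** — packaging: the Lucas monomial gives a `p^e`-companion element
`g ∈ Diff^{≤ n − p^e}_ℤ(J)` with `g ≡ z^{p^e} (mod 𝔪^{p^e+1})`, `z` a REGULAR PARAMETER (scalars of the
Hasse system any field
`k₀`; `p^e`-th roots of residues from `p`-th roots). (Sources: Giraud1975; EncinasVillamayor2000, Thm. 4.9; folklore.) -/
theorem exists_companion_of_presentation {k₀ : Type} [Field k₀] {S : Type} [CommRing S] [IsLocalRing S] [Algebra k₀ S]
    {ι : Type*} [Fintype ι] [DecidableEq ι] (p : ℕ) [Fact p.Prime] [CharP S p]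
    {u : ι → S} (hu : Ideal.span (Set.range u) = maximalIdeal S) {n : ℕ}
    {Δ : (ι →₀ ℕ) → (S →ₗ[k₀] S)} (h0 : ∀ b, Δ 0 b = b)
    (hL : ∀ q : ι →₀ ℕ, q.degree ≤ n →
      ∀ f g : S, Δ q (f * g) = ∑ c ∈ Finset.HasAntidiagonal.antidiagonal q, Δ c.1 f * Δ c.2 g)
    (hV : ∀ q β : ι →₀ ℕ, q.degree ≤ n →
      Δ q (∏ i, u i ^ β i) = ((∏ i ∈ q.support, (β i).choose (q i) : ℕ) : S) * ∏ i, u i ^ (β - q) i)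
    (hD : ∀ (d : ℕ) (q : ι →₀ ℕ), q.degree ≤ d → d ≤ n → IsDiffOpLE k₀ d (Δ q))
    (hperf : ∀ a : S, ∃ b : S, a - b ^ p ∈ maximalIdeal S)
    {e : ℕ} (hen : p ^ e ∣ n) {J : Ideal S} {f : S} (hfJ : f ∈ J)
    (Q : MvPolynomial ι S) (hQ : Q.IsHomogeneous (n / p ^ e))
    (hfQ : f - MvPolynomial.eval (fun i => u i ^ (p ^ e)) Q ∈ maximalIdeal S ^ (n + 1))
    {α₀ : ι →₀ ℕ} (hα₀ : α₀ ∈ Q.support) (hc : Q.coeff α₀ ∉ maximalIdeal S) {i : ι} (hi : ¬ p ∣ α₀ i) :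
    ∃ z ∈ maximalIdeal S, z ∉ maximalIdeal S ^ 2 ∧
      ∃ g ∈ diffIdeal ℤ (n - p ^ e) J, g - z ^ (p ^ e) ∈ maximalIdeal S ^ (p ^ e + 1) := by
  have hnm : n = p ^ e * (n / p ^ e) := (Nat.mul_div_cancel' hen).symm
  have hw1 : 1 ≤ p ^ e := Nat.one_le_pow _ _ (Fact.out : p.Prime).pos
  obtain ⟨q, hqdeg, hmem, hnot⟩ := exists_hasse_apply_companion hu h0 hL hV hD p hnm Q hQ hfQ hα₀ hc hi
  obtain ⟨s, hs, r, hr, hsr⟩ := Submodule.mem_sup.mp hmem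
  obtain ⟨z, hz, hsz⟩ := exists_pow_congr_of_mem_powSpan p e (exists_pow_pow_root_residue p hperf e) hs
  have hcong : Δ q f - z ^ (p ^ e) ∈ maximalIdeal S ^ (p ^ e + 1) := by
    have : Δ q f - z ^ (p ^ e) = (s - z ^ (p ^ e)) + r := by rw [← hsr]; ring
    rw [this]
    exact add_mem hsz hr
  refine ⟨z, hz, not_mem_sq_of_pow_congr_exp (maximalIdeal S) hw1 hnot (c := 1) (by simpa using hcong), Δ q f,
    diffIdeal_restrict_le (n - p ^ e) J (apply_mem_diffIdeal k₀ (hD (n - p ^ e) q (by omega) (by omega)) hfJ), hcong⟩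

end CompanionAlgebra

/-! ## §67 THE SCHEME-LEVEL COMPANION: existence at every closed point of every `p^e`-power stage over a perfect field -/

section SchemeCompanion

/-- **`CompanionContactAt w n 𝓘 y` — THE WEIGHT-`w` COMPANION HAS LINEAR WEAK CONTACT at `y`** (NEW OBJECT of this node,
intrinsic, no chart, no field): some `g ∈ Diff^{≤ n−w}_ℤ(𝓘_y)` (an element of Giraud's weight-`w`
COMPANION IDEAL of `𝓘`
at `y`) is `≡ z^w (mod 𝔪_y^{w+1})` with `z ∈ 𝔪_y ∖ 𝔪_y²` a REGULAR PARAMETER: the companion has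
order exactly `w` and its
initial form is the `w`-th power of a LINEAR form.  `w = 1`: absolute contact (`IsAbsContactAt`); `w = n`: g24's weak contact
of the ideal itself. DEFINITION (support). -/
def CompanionContactAt {Y : Scheme.{0}} (w n : ℕ) (I : Y.IdealSheafData) (y : Y) : Prop :=
  ∃ z ∈ maximalIdeal (Y.presheaf.stalk y), z ∉ maximalIdeal (Y.presheaf.stalk y) ^ 2 ∧
    ∃ g ∈ diffIdeal ℤ (n - w) (stalkIdeal I y), g - z ^ w ∈ maximalIdeal (Y.presheaf.stalk y) ^ (w + 1)

variable {K : Type} [Field K]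

/-- **THE COMPANION CONTACT THEOREM (KERNEL, PROVED, hypothesis-free, standard axioms).**  On a base of the class over a
PERFECT field of characteristic `p`, at a CLOSED point `y` where `𝓘` has order exactly `n ≥ 1` and its initial ideal is a
`p^e`-power form but not a `p^{e+1}`-power form (`e` = the FROBENIUS EXPONENT of `𝓘` at `y`; `e = 0` is g23's tame /
absolute-contact case, `p^e = n` is g24's weak-contact case), the weight-`p^e` companion `Diff^{≤ n − p^e}_ℤ(𝓘_y)` has
LINEAR WEAK CONTACT: `CompanionContactAt (p^e) n 𝓘 y`.  Regular stalk + EFT over perfect `K` ⟹ formally smooth ⟹ Hasse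
system (EGA IV₄ 16.11.2); `p`-th roots of residues at closed points; then §66.
(Sources: Giraud1975; EGAIV4, Thm. 16.11.2; StacksProject, Tag 00TV; EncinasVillamayor2000, Thm. 4.9; BGEV2012, Lemma 4.6;
KawanoueMatsuki2010; CossartPiltant2008 §2.) -/
theorem companionContactAt_of_pPowerFormAt {p : ℕ} (hp : p.Prime) [CharP K p] [PerfectField K] {Y : Scheme.{0}}
    (g : Y ⟶ Spec (.of K)) (hB : IsBase Y g) (I : Y.IdealSheafData) {n : ℕ} (e : ℕ) {y : Y}
    (hy : IsClosed ({y} : Set Y)) (hn : 0 < n) (hord : idealOrder I y = ((n : ℕ) : ℕ∞))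
    (hP : PPowerFormAt (p ^ e) I n y) (hP' : ¬ PPowerFormAt (p ^ (e + 1)) I n y) :
    CompanionContactAt (p ^ e) n I y := by
  classical
  obtain ⟨N, rfl⟩ : ∃ N, n = N + 1 := ⟨n - 1, by omega⟩
  obtain ⟨-, hnle⟩ := stalkIdeal_le_and_not_le_of_idealOrder I y hord
  haveI := Fact.mk hp
  haveI : LocallyOfFiniteType g := hB.locallyOfFiniteType
  let S := Y.presheaf.stalk y
  letI algKS : Algebra K S := stalkAlgebra (g.appTop.hom.comp (Scheme.ΓSpecIso (.of K)).inv.hom) y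
  haveI : Algebra.EssFiniteType K S := essFiniteType_stalk g y
  haveI : IsRegularLocalRing S := hB.isRegular y
  haveI : Algebra.FormallySmooth K S := formallySmooth_of_isRegularLocalRing_of_perfectField K S
  haveI : CharP S p := charP_of_injective_algebraMap (algebraMap K S).injective p
  obtain ⟨s, hcard, hspan⟩ :=
    Submodule.FG.exists_span_finset_card_eq_spanFinrank (IsNoetherian.noetherian (maximalIdeal S))
  have hu : Ideal.span (Set.range fun x : ↥s => (x : S)) = maximalIdeal S := by
    rw [Subtype.range_coe_subtype, Finset.setOf_mem]; exact hspan
  have hcard' : Fintype.card ↥s = (maximalIdeal S).spanFinrank := by rw [Fintype.card_coe]; exact hcard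
  obtain ⟨Δ, h0, hL, hV, hD⟩ :=
    exists_hasseSystem_of_span_eq_maximalIdeal (k := K) (fun x : ↥s => (x : S)) hu hcard' (N + 1)
  have hperf : ∀ a : S, ∃ b : S, a - b ^ p ∈ maximalIdeal S := fun a => exists_pth_root_residue p g hy a
  obtain ⟨f, hfJ, Q, hQ, hfQ, α₀, hα₀, hc, i, hi⟩ :=
    exists_companion_presentation p hu e hP.1 hP.2 (by simpa using hnle) hP'
  exact exists_companion_of_presentation p hu h0 hL hV hD hperf hP.1 hfJ Q hQ hfQ hα₀ hc hi

/-- **THE FROBENIUS EXPONENT EXISTS (KERNEL, PROVED)**: at a point of order exactly `n ≥ 1` there is `e` with `𝓘` a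
`p^e`-power form and not a `p^{e+1}`-power form at `y` (`p^0`-power form = order `≥ n`; `p^e ∣ n` bounds `e`). [folklore] -/
theorem exists_frobExp {p : ℕ} (hp : p.Prime) {Y : Scheme.{0}} (I : Y.IdealSheafData) {n : ℕ} {y : Y} (hn : 0 < n)
    (hord : idealOrder I y = ((n : ℕ) : ℕ∞)) :
    ∃ e : ℕ, PPowerFormAt (p ^ e) I n y ∧ ¬ PPowerFormAt (p ^ (e + 1)) I n y := by
  classical
  have h0 : PPowerFormAt (p ^ 0) I n y := by
    obtain ⟨N, rfl⟩ : ∃ N, n = N + 1 := ⟨n - 1, by omega⟩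
    refine ⟨by simp, ?_⟩
    obtain ⟨hle, -⟩ := stalkIdeal_le_and_not_le_of_idealOrder I y hord
    refine le_trans hle (le_trans ?_ le_sup_left)
    intro x hx
    exact Ideal.subset_span ⟨x, by simpa using hx, by simp⟩
  have hex : ∃ e, ¬ PPowerFormAt (p ^ (e + 1)) I n y := by
    refine ⟨n, fun h => ?_⟩
    have h1 := Nat.le_of_dvd hn h.1
    have h2 : n < p ^ (n + 1) := lt_of_lt_of_le (Nat.lt_succ_self n) (Nat.lt_pow_self hp.one_lt).le
    omega
  refine ⟨Nat.find hex, ?_, Nat.find_spec hex⟩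
  rcases (Nat.find hex).eq_zero_or_pos with h | h
  · rw [h]; exact h0
  · obtain ⟨e, he⟩ : ∃ e, Nat.find hex = e + 1 := ⟨Nat.find hex - 1, by omega⟩
    rw [he]
    have := Nat.find_min hex (show e < Nat.find hex by omega)
    push Not at this
    exact this

/-- **COROLLARY (KERNEL, PROVED): A COMPANION WITH LINEAR WEAK CONTACT EXISTS AT EVERY CLOSED POINT of positive order over
a perfect field** — for the Frobenius exponent `e` of `𝓘` at `y`. (Sources: as above.) -/
theorem exists_companionContactAt {p : ℕ} (hp : p.Prime) [CharP K p] [PerfectField K] {Y : Scheme.{0}}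
    (g : Y ⟶ Spec (.of K)) (hB : IsBase Y g) (I : Y.IdealSheafData) {n : ℕ} {y : Y}
    (hy : IsClosed ({y} : Set Y)) (hn : 0 < n) (hord : idealOrder I y = ((n : ℕ) : ℕ∞)) :
    ∃ e : ℕ, p ^ e ∣ n ∧ CompanionContactAt (p ^ e) n I y := by
  obtain ⟨e, hP, hP'⟩ := exists_frobExp hp I hn hord
  exact ⟨e, hP.1, companionContactAt_of_pPowerFormAt hp g hB I e hy hn hord hP hP'⟩

end SchemeCompanion

end Summit.ResolutionOfSingularities.ResolutionOfSingularities.Theorems.HugValuationCut
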